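import Summits.ABC.IUTFork.Cor312ThetaBoxesDH
import Literature.IUT.LogVolume.GenuineLogThetaIdeles
import HarnessLib

/-!
# [IUTchIII] Corollary 3.12 over the REAL log-shells with the VERBATIM volumes — the Dupuy–Hilado PILOT REGIONS
# READ OFF IDELES (sharp reading): `hθ`, `hfinθ`, `hq`, `hfin` PROVED ⇒ `BridgeHyps` at the assembled real setting
# from `ThetaFinite` alone

Record-only file (D-0012) of the abc-iut cell (Cor. 3.12 sub-crew, seat abc-iut-c312-3 = the L-DH level, gen 4;
D-0067 TEAM A row A-0); TAKES NO SIDE. Sequel of `Cor312ThetaBoxesDH` (boxes cut out summand by summand, `hθ`/`hfinθ`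
for admissible summand regions): here the summand regions are Dupuy–Hilado's, read off pilot IDELES of `F`.

* §1 (the SHARP reading, Dupuy–Hilado arXiv:2004.13228 §3.9 / plan R6-a, abc-iut-c312-3 `bareWitness` /
  `minimalDHDatumM`: `(𝒪_𝕃(−P_Θ))^{Ind3} := 𝒪_𝕃(−P_Θ)` itself): summand regions `ι_j(t_{Θ,j,v_j})·(R_I)^∼ ⊆
  F_{v_0} ⊗_{ℚ_p} ⋯ ⊗ F_{v_j}` from Θ-pilot ideles `t_{Θ,j,v} ∈ F_v^×` acting through the LAST tensor factor (§3.7)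
  — binders `t` with `t ≠ 0` and "`‖t_{Θ,j,v}‖ = 1` off `S`", both consequences of "`t` realises `P_Θ`" in the
  normalisation (3.4) (`norm_eq_one_of_realises`) —: positive finite measure (`packetAdm_sharpBoxDH`), log-measure
  `log ‖t_{Θ,j,v_j}‖` (`packetLogμ_sharpBoxDH`, (3.7)); `hθ` (`adm_thetaRegion3_sharp`), the log-volume
  `Σ_{v⃗} w_{v⃗}·log ‖t_{Θ,i+1,v_{i+1}}‖` (`logvol_thetaRegion3_sharp_inr`) and `hfinθ`
  (`finite_support_logvol_thetaRegion3_sharp`: support ⊆ the primes under `S`) PROVED; the binders are satisfiable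
  (`sharp_binders_satisfiable`, vacuity audit).
* §2 (the `q`-centre): `qCentreDH tq` from `q`-pilot ideles — `λ_{q,(v⃗,i)} = ψ_{v⃗}(ι_j(t_{q,v_j}))_i`, so that
  `λ_q·𝒪_L` pulls back to `Π_{v⃗} ι_j(t_{q,v_j})·(R_I)^∼ = 𝒪_𝕃(−P_q)_{p,j}` (§3.9) —: `hq` (`qCentreDH_ne_zero`), the
  log-volume (`logvol_qRegion_inr`) and `hfin` (`finite_support_logvol_qRegion`) PROVED.
* §3: **`settingDHVolSharp`** — abc-iut-c312-5's `settingDHVol` with EVERY pilot binder supplied (Θ-boxes,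
  `q`-centre, `hq`, `hfin`); binders left: the column `n`, the context data `lat`/`sig`/`split`/`qData`, the
  archimedean structures and (b)(c) data of the situation, the ideles — and **`bridgeHyps_settingDHVolSharp`**:
  abc-iut-c312-6's `BridgeHyps` for it from `ThetaFinite` ALONE (`mono`/`image_adm`/`image_fin`/`hul_nonempty`/
  `theta_nonempty` by c312-5, `hθ`/`hfinθ` here; `ThetaFinite` = "`−|log(Θ)| ∈ ℝ`" is c312-7's
  `hullDefined_of_stable` lane).
[claim: Mochizuki2012, status: disputed] for the quoted setting; [cite: DupuyHilado2025, Def. 3.6.1, §3.3, §3.4,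
§3.7, §3.9, §4.10]; [cite: Mochizuki2012, IUTchIII Rmk. 3.1.1 (iii) p. 96, Rmk. 3.9.5 (ii) p. 127, Prop. 3.9 (iii)
p. 115, IUTchIV Prop. 1.4 (i) p. 13]. Nothing here asserts that Cor. 3.12 holds, nor that the sharp reading is the
author's (the (4.10)-bounded reading is any other admissible family of `Cor312ThetaBoxesDH`); whether ideles
realising a given `P_Θ` exist in `F_v` is an arithmetic condition on the pilot data (campaign-S
`exists_units_log_norm_eq`), recorded, not assumed away. An instance ≠ an endorsement.
-/

noncomputable section

open Set Function NumberField IsDedekindDomain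
open scoped Pointwise

namespace Summit.ABC

namespace IUTFork

namespace Thm311

namespace Real

open Cor312 Cor312Vol Literature.IUT.LogThetaLattice Literature.IUT.LogVolume

variable {F : Type} [Field F] [NumberField F] (X : PilotData F) {logv : PadicLogs F} (hlog : LogvAnalytic logv)

/-! Context binders of abc-iut-c312-5's `settingDHVol` (column, situation data, lattice/signature/`q`-pilot data,
a `q`-centre with `hq`/`hfin`), shared by the setting-level theorems below. -/

variable (M : Type) [Field M] [NumberField M]
  (archPk : ∀ (j : (thetaIndex X).Label) (vQ : (thetaIndex X).VQ), Set ((logShellsDH X logv).Packet j vQ))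
  (archSub : ∀ (j : (thetaIndex X).Label) (v : (thetaIndex X).V),
    Set ((logShellsDH X logv).Packet j ((thetaIndex X).over v)))
  (Ψ : ℤ → ∀ v : (thetaIndex X).V, v ∈ (thetaIndex X).Vbad → Set ((logShellsDH X logv).StarPacket v))
  (act : ℤ → ∀ v : (thetaIndex X).V, v ∈ (thetaIndex X).Vbad →
    (logShellsDH X logv).StarPacket v → Module.End ℚ ((logShellsDH X logv).StarPacket v))
  (Mmod : ℤ → ∀ j : (thetaIndex X).LabelStar, Set ((logShellsDH X logv).GlobalPacket j.1))
  (region : ℤ → ∀ j : (thetaIndex X).LabelStar, FinDivisor M → ∀ vQ : (thetaIndex X).VQ,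
    Set ((logShellsDH X logv).Packet j.1 vQ))
  (n : ℤ) {HT : Type} {LogLink : HT → HT → Type} {IsFull : ∀ {s t : HT}, LogLink s t → Prop}
  (lat : LGPGaussianLogThetaLattice LogLink IsFull)
  {Frd : Type} {IsoF : Frd → Frd → Type} {Ob : Frd → Type} {realify : Frd → Frd} {Strip : Type}
  {IsoS : Strip → Strip → Type} {Mv : ∀ v : (thetaIndex X).V, v ∈ (thetaIndex X).Vbad → Type}
  [∀ v h, Monoid (Mv v h)]
  (sig : GlobalLGPFrobenioidSignature (thetaIndex X).lstar (thetaIndex X).V (· ∈ (thetaIndex X).Vbad)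
    Frd IsoF Ob realify Strip IsoS Mv)
  (split : SplittingMonoids Mv) {ObΔ : Type} {N : ∀ v : (thetaIndex X).V, v ∈ (thetaIndex X).Vbad → Type}
  [∀ v h, Monoid (N v h)] (qData : QPilotData ObΔ N)
  (qCentre : ObΔ → ∀ (j : (thetaIndex X).Label) (vQ : (thetaIndex X).VQ),
    ∀ s : factorIdxDH X hlog j vQ, factorFieldDH X hlog j vQ s)
  (hq : ∀ j vQ s, qCentre (qPilotObject qData) j vQ s ≠ 0)
  (hfin : ∀ j : (thetaIndex X).Label, (Function.support fun vQ =>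
    ((situationDHVol X hlog M archPk archSub Ψ act Mmod region).D n).logvol j vQ
      (factorMapDH X hlog j vQ ⁻¹' hullSet (factorFieldDH X hlog j vQ) (qCentre (qPilotObject qData) j vQ))).Finite)

/-! ## §1. The SHARP reading: summand regions `ι_j(t_{Θ,j,v_j})·(R_I)^∼` from Θ-pilot ideles -/

section Sharp

variable (t : ∀ (pp : Nat.Primes) (_ : Fin X.lstar) (x : (thetaIndex X).Fibre (.inr pp)),
  haveI : Fact (pp : ℕ).Prime := ⟨pp.2⟩; kOf X pp.1 x)

/-- The Θ-idele at the LABEL `j ∈ {0,…,l⋇}`: `t_{Θ,j,v}` for `j ≥ 1`, and `1` at the label `0` (no Θ-pilot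
component there; Dupuy–Hilado §3.9 "`𝒪_{v⃗}` in the other degrees"). [cite: DupuyHilado2025, §3.9] -/
def labelIdele (pp : Nat.Primes) (j : (thetaIndex X).Label) (x : (thetaIndex X).Fibre (.inr pp)) :
    haveI : Fact (pp : ℕ).Prime := ⟨pp.2⟩; kOf X pp.1 x :=
  haveI : Fact (pp : ℕ).Prime := ⟨pp.2⟩
  if h : 0 < (j : ℕ) then
    t pp ⟨(j : ℕ) - 1, by have hj : (j : ℕ) < X.lstar + 1 := j.2; omega⟩ x
  else 1

/-- At the label `j = i+1` the label idele is `t_{Θ,i+1,v}`. [cite: DupuyHilado2025, §3.9] -/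
theorem labelIdele_labelSucc (pp : Nat.Primes) (i : Fin (thetaIndex X).lstar)
    (x : (thetaIndex X).Fibre (.inr pp)) :
    labelIdele X t pp (Setting.labelSucc i) x = t pp i x := by
  unfold labelIdele
  have h0 : 0 < ((Setting.labelSucc i : (thetaIndex X).Label) : ℕ) := by
    simp [Setting.labelSucc]
  rw [dif_pos h0]
  congr 1

/-- The label idele is non-zero when the ideles are. [folklore] -/
theorem labelIdele_ne_zero (ht0 : ∀ pp i x, t pp i x ≠ 0) (pp : Nat.Primes) (j : (thetaIndex X).Label)
    (x : (thetaIndex X).Fibre (.inr pp)) : labelIdele X t pp j x ≠ 0 := by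
  unfold labelIdele
  split_ifs
  · exact ht0 _ _ _
  · exact one_ne_zero

/-- **The SHARP Dupuy–Hilado summand region** `ι_j(t_{Θ,j,v_j})·(R_I)^∼ ⊆ F_{v_0} ⊗_{ℚ_p} ⋯ ⊗ F_{v_j}` — the
`(p, j, v⃗)`-component of `𝒪_𝕃(−P_Θ)` (Dupuy–Hilado §3.9: the idele acts through the LAST tensor factor, §3.7),
taken AS the (Ind3)-region (the sharp reading, plan R6-a; c312-3 `bareWitness`/`minimalDHDatumM`).
[cite: DupuyHilado2025, §3.7, §3.9] -/
def sharpBoxDH (pp : Nat.Primes) (j : (thetaIndex X).Label)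
    (e : (thetaIndex X).Caps j → (thetaIndex X).Fibre (.inr pp)) :
    haveI : Fact (pp : ℕ).Prime := ⟨pp.2⟩; Set ((presAt X hlog pp).X e) :=
  haveI : Fact (pp : ℕ).Prime := ⟨pp.2⟩
  iota pp.1 ((presAt X hlog pp).kk e) (Fin.last _) (labelIdele X t pp j (e (Fin.last _))) •
    (normalizedPacket pp.1 ((presAt X hlog pp).kk e) : Set ((presAt X hlog pp).X e))

/-- The sharp region has positive finite Haar measure (a nondegenerate translate of `(R_I)^∼`).
[cite: DupuyHilado2025, §3.7] -/
theorem packetAdm_sharpBoxDH (ht0 : ∀ pp i x, t pp i x ≠ 0) (pp : Nat.Primes) (j : (thetaIndex X).Label)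
    (e : (thetaIndex X).Caps j → (thetaIndex X).Fibre (.inr pp)) :
    haveI : Fact (pp : ℕ).Prime := ⟨pp.2⟩
    PacketAdm pp.1 ((presAt X hlog pp).kk e) (sharpBoxDH X hlog t pp j e) := by
  haveI : Fact (pp : ℕ).Prime := ⟨pp.2⟩
  haveI : Nonempty ((thetaIndex X).Caps j) := ⟨0⟩
  exact packetAdm_iota_smul pp.1 _ (Fin.last _) (labelIdele_ne_zero X t ht0 pp j _)
    (packetAdm_normalizedPacket pp.1 _)

/-- **(3.7)**: the log-measure of the sharp region is `log ‖t_{Θ,j,v_j}‖` (`= −P_{Θ,j}(v_j)·ln|κ(v_j)|/n_{v_j}` when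
`t` realises `P_Θ`, Dupuy–Hilado (3.4)). [cite: DupuyHilado2025, §3.4, §3.7] -/
theorem packetLogμ_sharpBoxDH (ht0 : ∀ pp i x, t pp i x ≠ 0) (pp : Nat.Primes) (j : (thetaIndex X).Label)
    (e : (thetaIndex X).Caps j → (thetaIndex X).Fibre (.inr pp)) :
    haveI : Fact (pp : ℕ).Prime := ⟨pp.2⟩
    packetLogμ pp.1 ((presAt X hlog pp).kk e) (sharpBoxDH X hlog t pp j e) =
      Real.log ‖labelIdele X t pp j (e (Fin.last _))‖ := by
  haveI : Fact (pp : ℕ).Prime := ⟨pp.2⟩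
  haveI : Nonempty ((thetaIndex X).Caps j) := ⟨0⟩
  exact packetLogμ_iota_smul_normalizedPacket pp.1 _ (Fin.last _) (labelIdele_ne_zero X t ht0 pp j _)

/-- Ideles realising `P_Θ` in Dupuy–Hilado's normalisation (3.4) — `log ‖t_{Θ,j,v}‖ = −P_{Θ,j}(v)·ln|κ(v)|/n_v` —
are UNITS off `S` (`P_{Θ,j}` is supported on `S`). [cite: DupuyHilado2025, §3.3, §3.4] -/
theorem norm_eq_one_of_realises (ht0 : ∀ pp i x, t pp i x ≠ 0)
    (ht : ∀ (pp : Nat.Primes) (i : Fin X.lstar) (x : (thetaIndex X).Fibre (.inr pp)),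
      haveI : Fact (pp : ℕ).Prime := ⟨pp.2⟩
      Real.log ‖t pp i x‖ = -(X.thetaPilot i (placeOf X pp.1 x)) * logNorm F (placeOf X pp.1 x) /
        localDegree F (placeOf X pp.1 x))
    (pp : Nat.Primes) (i : Fin X.lstar) (x : (thetaIndex X).Fibre (.inr pp))
    (hx : haveI : Fact (pp : ℕ).Prime := ⟨pp.2⟩; placeOf X pp.1 x ∉ X.S) :
    haveI : Fact (pp : ℕ).Prime := ⟨pp.2⟩; ‖t pp i x‖ = 1 := by
  haveI : Fact (pp : ℕ).Prime := ⟨pp.2⟩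
  have h := ht pp i x
  rw [PilotData.thetaPilot_apply_of_not_mem X i hx, neg_zero, zero_mul, zero_div] at h
  rcases Real.log_eq_zero.mp h with h0 | h1 | hm1
  · exact absurd (norm_eq_zero.mp h0) (ht0 pp i x)
  · exact h1
  · exact absurd hm1 (by have := norm_nonneg (t pp i x); intro h'; linarith)

/-- **The binders of the sharp boxes are satisfiable** (vacuity audit, LANA Rem. 8.2.1 style): the unit ideles
`t ≡ 1` are non-zero and of norm `1` everywhere (they realise `P_Θ` only for the zero pilot; a family realising a
given `P_Θ` exists iff its coefficients are attained rescaled norms — campaign-S `exists_units_log_norm_eq`).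
[folklore] -/
theorem sharp_binders_satisfiable :
    ∃ t : ∀ (pp : Nat.Primes) (_ : Fin X.lstar) (x : (thetaIndex X).Fibre (.inr pp)),
        haveI : Fact (pp : ℕ).Prime := ⟨pp.2⟩; kOf X pp.1 x,
      (∀ pp i x, t pp i x ≠ 0) ∧
        ∀ (pp : Nat.Primes) (i : Fin X.lstar) (x : (thetaIndex X).Fibre (.inr pp)),
          haveI : Fact (pp : ℕ).Prime := ⟨pp.2⟩; ‖t pp i x‖ = 1 :=
  ⟨fun _ _ _ => 1, fun _ _ _ => one_ne_zero, fun _ _ _ => norm_one⟩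

/-- **`hθ` PROVED for the sharp Dupuy–Hilado boxes**: the (Ind3)-enlarged Θ-region of the assembled real setting
is admissible in the verbatim container at every `(j, v_ℚ)`. [claim: Mochizuki2012, status: disputed] -/
theorem adm_thetaRegion3_sharp (ht0 : ∀ pp i x, t pp i x ≠ 0) (j : (thetaIndex X).Label)
    (vQ : (thetaIndex X).VQ) :
    ((situationDHVol X hlog M archPk archSub Ψ act Mmod region).D n).Adm j vQ
      ((settingDHVol X hlog M archPk archSub Ψ act Mmod region n lat sig split qData
        (fun _ _ => thetaBoxDH X hlog (sharpBoxDH X hlog t)) qCentre hq hfin).thetaRegion3 j vQ) :=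
  adm_thetaRegion3_thetaBoxDH X hlog (sharpBoxDH X hlog t) M archPk archSub Ψ act Mmod region n lat sig split
    qData qCentre hq hfin (packetAdm_sharpBoxDH X hlog t ht0) j vQ

/-- **The log-volume of the sharp (Ind3)-region at `(i+1, p)`** is `Σ_{v⃗} w_{v⃗}·log ‖t_{Θ,i+1,v_{i+1}}‖` — the
Dupuy–Hilado-level "`−deg` of the Θ-pilot" shape (Thm. 3.10.1 of their text reads it as `−deĝ`).
[cite: DupuyHilado2025, §3.7, §3.9] -/
theorem logvol_thetaRegion3_sharp_inr (ht0 : ∀ pp i x, t pp i x ≠ 0) (i : Fin (thetaIndex X).lstar)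
    (pp : Nat.Primes) :
    ((situationDHVol X hlog M archPk archSub Ψ act Mmod region).D n).logvol (Setting.labelSucc i) (.inr pp)
      ((settingDHVol X hlog M archPk archSub Ψ act Mmod region n lat sig split qData
        (fun _ _ => thetaBoxDH X hlog (sharpBoxDH X hlog t)) qCentre hq hfin).thetaRegion3
          (Setting.labelSucc i) (.inr pp)) =
      haveI : Fact (pp : ℕ).Prime := ⟨pp.2⟩
      ∑ e : (presAt X hlog pp).toLocalPieces.E (Setting.labelSucc i),
        weightDH X (Setting.labelSucc i) * Real.log ‖t pp i (e (Fin.last _))‖ := by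
  haveI : Fact (pp : ℕ).Prime := ⟨pp.2⟩
  rw [logvol_thetaRegion3_thetaBoxDH_inr X hlog (sharpBoxDH X hlog t) M archPk archSub Ψ act Mmod region n lat
    sig split qData qCentre hq hfin (packetAdm_sharpBoxDH X hlog t ht0)]
  refine Finset.sum_congr rfl fun e _ => ?_
  rw [packetLogμ_sharpBoxDH X hlog t ht0, labelIdele_labelSucc]

/-- **`hfinθ` PROVED for the sharp Dupuy–Hilado boxes**: for Θ-ideles that are units off `S` (e.g. realising
`P_Θ`, `norm_eq_one_of_realises`), the log-volume of the (Ind3)-enlarged Θ-region at every label `j = i+1` is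
supported on the (finitely many) primes under `S`. [claim: Mochizuki2012, status: disputed] -/
theorem finite_support_logvol_thetaRegion3_sharp (ht0 : ∀ pp i x, t pp i x ≠ 0)
    (ht1 : ∀ (pp : Nat.Primes) (i : Fin X.lstar) (x : (thetaIndex X).Fibre (.inr pp)),
      haveI : Fact (pp : ℕ).Prime := ⟨pp.2⟩; placeOf X pp.1 x ∉ X.S → ‖t pp i x‖ = 1)
    (i : Fin (thetaIndex X).lstar) :
    (Function.support fun vQ : (thetaIndex X).VQ =>
      ((situationDHVol X hlog M archPk archSub Ψ act Mmod region).D n).logvol _ vQ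
        ((settingDHVol X hlog M archPk archSub Ψ act Mmod region n lat sig split qData
          (fun _ _ => thetaBoxDH X hlog (sharpBoxDH X hlog t)) qCentre hq hfin).thetaRegion3
            (Setting.labelSucc i) vQ)).Finite := by
  refine finite_support_logvol_thetaRegion3_thetaBoxDH X hlog (sharpBoxDH X hlog t) M archPk archSub Ψ act Mmod region n lat
    sig split qData qCentre hq hfin (packetAdm_sharpBoxDH X hlog t ht0) (Setting.labelSucc i)
    ((finite_primes_under_S X).subset ?_)
  rintro pp ⟨e, he⟩
  haveI : Fact (pp : ℕ).Prime := ⟨pp.2⟩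
  rw [packetLogμ_sharpBoxDH X hlog t ht0, labelIdele_labelSucc] at he
  by_contra hpp
  have hx : placeOf X pp.1 (e (Fin.last _)) ∉ X.S := fun hS => hpp ⟨_, hS, natCast_mem_placeOf X pp.1 _⟩
  exact he (by rw [ht1 pp i _ hx, Real.log_one])

end Sharp

/-! ## §2. The `q`-centre from `q`-pilot ideles; §3. the setting with every pilot binder supplied -/

section QCentre

variable (tq : ∀ (pp : Nat.Primes) (x : (thetaIndex X).Fibre (.inr pp)),
  haveI : Fact (pp : ℕ).Prime := ⟨pp.2⟩; kOf X pp.1 x)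

/-- **The Dupuy–Hilado `q`-centre** `λ_q` of the field-factor product read off `q`-pilot ideles `t_{q,v} ∈ F_v^×`:
at a prime, `λ_{q,(v⃗,i)} = ψ_{v⃗}(ι_j(t_{q,v_j}))_i` — so that `λ_q·𝒪_L` pulls back to `Π_{v⃗} ι_j(t_{q,v_j})·(R_I)^∼`,
the `(p, j, v⃗)`-components of `𝒪_𝕃(−P_q)` (Dupuy–Hilado §3.9) —; at `∞` the empty tuple (no factor there: the
parent files' modelling choice). [cite: DupuyHilado2025, §3.9] -/
def qCentreDH : ∀ (j : (thetaIndex X).Label) (vQ : (thetaIndex X).VQ),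
    ∀ s : factorIdxDH X hlog j vQ, factorFieldDH X hlog j vQ s
  | _, .inl _ => fun s => s.elim
  | _, .inr pp => haveI : Fact (pp : ℕ).Prime := ⟨pp.2⟩;
      (presAt X hlog pp).centreOf fun e =>
        iota pp.1 ((presAt X hlog pp).kk e) (Fin.last _) (tq pp (e (Fin.last _)))

/-- **`hq` PROVED**: every component of the `q`-centre is non-zero (`ψ(ι_j(a))_i` has norm `‖a‖`).
[cite: Mochizuki2012, IUTchIV Prop. 1.4 (i) p. 13] -/
theorem qCentreDH_ne_zero (htq0 : ∀ pp x, tq pp x ≠ 0) :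
    ∀ (j : (thetaIndex X).Label) (vQ : (thetaIndex X).VQ) (s : factorIdxDH X hlog j vQ),
      qCentreDH X hlog tq j vQ s ≠ 0
  | _, .inl _, s => s.elim
  | j, .inr pp, ⟨e, i⟩ => by
    haveI : Fact (pp : ℕ).Prime := ⟨pp.2⟩
    exact dEquiv_iota_ne_zero pp.1 ((presAt X hlog pp).kk e) (Fin.last _) (htq0 pp _) i

/-- **The log-volume of the `q`-pilot region at a prime** is `Σ_{v⃗} w_{v⃗}·log ‖t_{q,v_j}‖`.
[cite: DupuyHilado2025, §3.7, §3.9] -/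
theorem logvol_qRegion_inr (htq0 : ∀ pp x, tq pp x ≠ 0) (j : (thetaIndex X).Label) (pp : Nat.Primes) :
    ((situationDHVol X hlog M archPk archSub Ψ act Mmod region).D n).logvol j (.inr pp)
      (factorMapDH X hlog j (.inr pp) ⁻¹' hullSet (factorFieldDH X hlog j (.inr pp))
        (qCentreDH X hlog tq j (.inr pp))) =
      haveI : Fact (pp : ℕ).Prime := ⟨pp.2⟩
      ∑ e : (presAt X hlog pp).toLocalPieces.E j, weightDH X j * Real.log ‖tq pp (e (Fin.last _))‖ := by
  haveI : Fact (pp : ℕ).Prime := ⟨pp.2⟩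
  haveI : Nonempty ((thetaIndex X).Caps j) := ⟨0⟩
  have hg : ∀ (e : (thetaIndex X).Caps j → (thetaIndex X).Fibre (.inr pp)) (i : DIdx pp.1 ((presAt X hlog pp).kk e)),
      dEquiv pp.1 ((presAt X hlog pp).kk e)
        (iota pp.1 ((presAt X hlog pp).kk e) (Fin.last _) (tq pp (e (Fin.last _)))) i ≠ 0 :=
    fun e i => dEquiv_iota_ne_zero pp.1 _ (Fin.last _) (htq0 pp _) i
  have h := (presAt X hlog pp).factorMap_preimage_hullSet_centreOf
    (fun e => iota pp.1 ((presAt X hlog pp).kk e) (Fin.last _) (tq pp (e (Fin.last _)))) hg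
  have hadm : ∀ e : (thetaIndex X).Caps j → (thetaIndex X).Fibre (.inr pp),
      PacketAdm pp.1 ((presAt X hlog pp).kk e)
        (iota pp.1 ((presAt X hlog pp).kk e) (Fin.last _) (tq pp (e (Fin.last _))) •
          (normalizedPacket pp.1 ((presAt X hlog pp).kk e) : Set ((presAt X hlog pp).X e))) :=
    fun e => packetAdm_iota_smul pp.1 _ (Fin.last _) (htq0 pp _) (packetAdm_normalizedPacket pp.1 _)
  have key := SummandPieces.logvol_preimage_pi (summandPiecesDH X hlog) j (.inr pp) hadm
  change (summandPiecesDH X hlog).logvol j (.inr pp)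
    ((fun x => (presAt X hlog pp).factorMap j x) ⁻¹'
      hullSet ((presAt X hlog pp).factorField j) ((presAt X hlog pp).centreOf fun e =>
        iota pp.1 ((presAt X hlog pp).kk e) (Fin.last _) (tq pp (e (Fin.last _))))) = _
  rw [h]
  refine key.trans (Finset.sum_congr rfl fun e _ => ?_)
  show weightDH X j * packetLogμ pp.1 ((presAt X hlog pp).kk e) _ = _
  rw [packetLogμ_iota_smul_normalizedPacket pp.1 _ (Fin.last _) (htq0 pp _)]
  rfl

/-- The support of `v_ℚ ↦ log-volume of the q-pilot region at (j, v_ℚ)` lies among the primes under `S`, for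
`q`-ideles that are units off `S`. [folklore] -/
theorem support_logvol_qRegion_subset (htq0 : ∀ pp x, tq pp x ≠ 0)
    (htq1 : ∀ (pp : Nat.Primes) (x : (thetaIndex X).Fibre (.inr pp)),
      haveI : Fact (pp : ℕ).Prime := ⟨pp.2⟩; placeOf X pp.1 x ∉ X.S → ‖tq pp x‖ = 1)
    (j : (thetaIndex X).Label) :
    (Function.support fun vQ => ((situationDHVol X hlog M archPk archSub Ψ act Mmod region).D n).logvol j vQ
      (factorMapDH X hlog j vQ ⁻¹' hullSet (factorFieldDH X hlog j vQ) (qCentreDH X hlog tq j vQ))) ⊆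
      Sum.inr '' {pp : Nat.Primes | ∃ v ∈ X.S, ((pp : ℕ) : 𝓞 F) ∈ v.asIdeal} := by
  intro vQ hvQ
  rw [Function.mem_support] at hvQ
  cases vQ with
  | inl u => exact absurd (logvol_situationDHVol_inl X hlog M archPk archSub Ψ act Mmod region n u j _) hvQ
  | inr pp =>
    refine ⟨pp, ?_, rfl⟩
    haveI : Fact (pp : ℕ).Prime := ⟨pp.2⟩
    by_contra hpp
    apply hvQ
    rw [logvol_qRegion_inr X hlog M archPk archSub Ψ act Mmod region n tq htq0 j pp]
    refine Finset.sum_eq_zero fun e _ => ?_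
    have hx : placeOf X pp.1 (e (Fin.last _)) ∉ X.S := fun hS => hpp ⟨_, hS, natCast_mem_placeOf X pp.1 _⟩
    rw [htq1 pp _ hx, Real.log_one, mul_zero]

/-- **`hfin` PROVED**: for `q`-ideles that are units off `S` (e.g. realising `P_q`), the log-volume of the `q`-pilot
region at every label is supported on the (finitely many) primes under `S` ([IUTchIII] Prop. 3.9 (iii)).
[claim: Mochizuki2012, status: disputed] -/
theorem finite_support_logvol_qRegion (htq0 : ∀ pp x, tq pp x ≠ 0)
    (htq1 : ∀ (pp : Nat.Primes) (x : (thetaIndex X).Fibre (.inr pp)),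
      haveI : Fact (pp : ℕ).Prime := ⟨pp.2⟩; placeOf X pp.1 x ∉ X.S → ‖tq pp x‖ = 1)
    (j : (thetaIndex X).Label) :
    (Function.support fun vQ => ((situationDHVol X hlog M archPk archSub Ψ act Mmod region).D n).logvol j vQ
      (factorMapDH X hlog j vQ ⁻¹' hullSet (factorFieldDH X hlog j vQ) (qCentreDH X hlog tq j vQ))).Finite :=
  ((finite_primes_under_S X).image _).subset
    (support_logvol_qRegion_subset X hlog M archPk archSub Ψ act Mmod region n tq htq0 htq1 j)

/-- **The setting of [IUTchIII] Cor. 3.12 over the REAL log-shells of `F` with the VERBATIM volumes and the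
Dupuy–Hilado PILOT REGIONS READ OFF IDELES** (sharp reading): c312-5's `settingDHVol` with the Θ-boxes
`ι_j(t_{Θ,j,v_j})·(R_I)^∼`, the `q`-centre `ψ(ι_j(t_{q,v_j}))`, `hq` and `hfin` SUPPLIED. Binders left: the column
`n`, the context data `lat`/`sig`/`split`/`qData`, the archimedean structures and (b)(c) data of the situation, and
the ideles `t`, `tq` (non-zero; `tq` units off `S`). The pilot regions are constant in the abstract pilot OBJECTS of
`sig`/`qData`: at the Dupuy–Hilado level those enter only through their degrees `P_Θ`, `P_q`, recorded by `X`
(abc-iut-c312-8 `IsPilotDataOf`) and realised by the ideles. [claim: Mochizuki2012, status: disputed] -/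
def settingDHVolSharp
    (t : ∀ (pp : Nat.Primes) (_ : Fin X.lstar) (x : (thetaIndex X).Fibre (.inr pp)),
      haveI : Fact (pp : ℕ).Prime := ⟨pp.2⟩; kOf X pp.1 x)
    (htq0 : ∀ pp x, tq pp x ≠ 0)
    (htq1 : ∀ (pp : Nat.Primes) (x : (thetaIndex X).Fibre (.inr pp)),
      haveI : Fact (pp : ℕ).Prime := ⟨pp.2⟩; placeOf X pp.1 x ∉ X.S → ‖tq pp x‖ = 1) :
    Cor312.Setting (situationDHVol X hlog M archPk archSub Ψ act Mmod region) :=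
  settingDHVol X hlog M archPk archSub Ψ act Mmod region n lat sig split qData
    (fun _ _ => thetaBoxDH X hlog (sharpBoxDH X hlog t)) (fun _ => qCentreDH X hlog tq)
    (qCentreDH_ne_zero X hlog tq htq0)
    (finite_support_logvol_qRegion X hlog M archPk archSub Ψ act Mmod region n tq htq0 htq1)

/-- The column of `settingDHVolSharp` is `n`. [folklore] -/
theorem settingDHVolSharp_n
    (t : ∀ (pp : Nat.Primes) (_ : Fin X.lstar) (x : (thetaIndex X).Fibre (.inr pp)),
      haveI : Fact (pp : ℕ).Prime := ⟨pp.2⟩; kOf X pp.1 x)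
    (htq0 : ∀ pp x, tq pp x ≠ 0)
    (htq1 : ∀ (pp : Nat.Primes) (x : (thetaIndex X).Fibre (.inr pp)),
      haveI : Fact (pp : ℕ).Prime := ⟨pp.2⟩; placeOf X pp.1 x ∉ X.S → ‖tq pp x‖ = 1) :
    (settingDHVolSharp X hlog M archPk archSub Ψ act Mmod region n lat sig split qData tq t htq0 htq1).n = n :=
  rfl

/-- **c312-6's `BridgeHyps` for the real setting with the verbatim volumes and the sharp Dupuy–Hilado pilot
regions, from `ThetaFinite` ALONE**: `mono`, `image_adm`, `image_fin`, `hul_nonempty`, `theta_nonempty` (c312-5)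
and now `hθ`, `hfinθ` (this file) are DISCHARGED, for Θ-ideles that are units off `S`; the remaining input
`ThetaFinite` ("`−|log(Θ)| ∈ ℝ`", the first clause of Cor. 3.12) is c312-7's `hullDefined_of_stable` lane.
[claim: Mochizuki2012, status: disputed] -/
theorem bridgeHyps_settingDHVolSharp
    (t : ∀ (pp : Nat.Primes) (_ : Fin X.lstar) (x : (thetaIndex X).Fibre (.inr pp)),
      haveI : Fact (pp : ℕ).Prime := ⟨pp.2⟩; kOf X pp.1 x)
    (ht0 : ∀ pp i x, t pp i x ≠ 0)
    (ht1 : ∀ (pp : Nat.Primes) (i : Fin X.lstar) (x : (thetaIndex X).Fibre (.inr pp)),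
      haveI : Fact (pp : ℕ).Prime := ⟨pp.2⟩; placeOf X pp.1 x ∉ X.S → ‖t pp i x‖ = 1)
    (htq0 : ∀ pp x, tq pp x ≠ 0)
    (htq1 : ∀ (pp : Nat.Primes) (x : (thetaIndex X).Fibre (.inr pp)),
      haveI : Fact (pp : ℕ).Prime := ⟨pp.2⟩; placeOf X pp.1 x ∉ X.S → ‖tq pp x‖ = 1)
    (finite : (settingDHVolSharp X hlog M archPk archSub Ψ act Mmod region n lat sig split qData tq t htq0
      htq1).ThetaFinite) :
    BridgeHyps (settingDHVolSharp X hlog M archPk archSub Ψ act Mmod region n lat sig split qData tq t htq0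
      htq1) :=
  bridgeHyps_settingDHVol X hlog M archPk archSub Ψ act Mmod region n lat sig split qData _ _ _ _
    (fun _ vQ => adm_thetaRegion3_sharp X hlog M archPk archSub Ψ act Mmod region n lat sig split qData _ _ _ t ht0
      _ vQ)
    (fun i => finite_support_logvol_thetaRegion3_sharp X hlog M archPk archSub Ψ act Mmod region n lat sig split
      qData _ _ _ t ht0 ht1 i)
    finite

end QCentre

end Real

end Thm311

end IUTFork

end Summit.ABC

end
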